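import Literature.Probability.Percolation.NearCriticalRSW
import Literature.Probability.Percolation.NearCriticalFourArmFacts
import Mathlib.Analysis.SpecialFunctions.Pow.Real
import HarnessLib

/-!
# The equivalence of characteristic lengths `L_ε ≍ L_{ε'}` (Nolin 2008, Cor. 37) from Kesten's relation

Topic `Literature/Probability/Percolation`; family `crit-perc`. Proofs only (no new named fact,
no new definition). Nolin 2008, §7.3, Cor. 37 [arXiv 0711.4948: Cor. 35]: "For any
`ε, ε' ∈ (0, 1/2)`, `L_ε(p) ≍ L_{ε'}(p)`" — the step through which Nolin's Lemma 39 (uniform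
exponential decay above `L_ε(p)`) and Cor. 41 (`θ(p) ≍ P_p(0 ↔ ∂S_{L_ε(p)})`) pass from the small
`ε` "given by RSW" to every `ε ∈ (0, 1/2)` (proof of Lemma 39, last paragraph: "The result for any
`ε ∈ (0, 1/2)` follows readily by using the equivalence of lengths for different values of `ε`").

## The printed proof (arXiv 0711.4948, p. 26) and its transcription

"To fix ideas, assume that `ε ≤ ε'`, so that `L_ε(p) ≥ L_{ε'}(p)`, and we need to prove that
`L_ε(p) ≤ C L_{ε'}(p)` for some constant `C`. We know that
`|p - 1/2| L_ε(p)² π₄(L_ε(p)) ≍ 1 ≍ |p - 1/2| L_{ε'}(p)² π₄(L_{ε'}(p))`, hence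
`L_ε(p)² π₄(L_ε(p)) / (L_{ε'}(p)² π₄(L_{ε'}(p))) ≤ C₁`. This yields
`(L_ε/L_{ε'})² ≤ C₁ π₄(L_{ε'}) / π₄(L_ε) ≤ C₂ π₄(L_{ε'}, L_ε)⁻¹` by quasi-multiplicativity. Now we
use the a-priori bound for `4` arms given by the `5`-arm exponent:
`π₄(L_{ε'}, L_ε) ≥ (L_{ε'}/L_ε)^{-α'} π₅(L_{ε'}, L_ε) ≥ C₃ (L_{ε'}/L_ε)^{2-α'}`. Together with the
previous equation, it implies the result: `L_ε(p) ≤ C₄^{1/α'} L_{ε'}(p)`."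

The three inputs are named facts of the tree, consumed as hypotheses: Kesten's relation
`Nolin2008_prop34` (`KestenScaling.lean`; `|p - 1/2| L_ε(p)² π₄(r₀, L_ε(p)) ∈ [c, C]` near `1/2`,
`π₄(r₀, ·) = critFourArmProb r₀`, for every large inner radius `r₀`), and, AT `t = 1/2` ONLY (where
they carry no upper restriction on the radii, and `fourArmProbAt half = critFourArmProb` by
`fourArmProbAt_half`), the quasi-multiplicativity `Werner2009_fourArm_quasiMult`
(`c π₄(r, R) π₄(4R, S) ≤ π₄(r, S)`) and the a-priori bound `Werner2009_fourArm_lowerBound`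
(`c (m/n)^{2-β} ≤ π₄(m, n)`) of `NearCriticalFourArmFacts.lean`. The argument only uses the LOWER
Kesten bound at the smaller length and the UPPER one at the larger length, so it is written once
for an abstract pair of scales (`length_le_mul_of_kesten_bounds`: if `c₁ ≤ a L² π₄(r₀, L)`,
`a L'² π₄(r₀, L') ≤ C₂` and `L > 4 r₀`, then `L' ≤ K L` with `K` depending on the constants only;
the case `L' ≤ 4L` being trivial, quasi-multiplicativity is applied to `r₀ < L < 4L < L'`), and then
specialised twice:

* `charLength_le_mul_charLength_of_kesten(_lt)` — **Cor. 37** for Nolin's rhombus lengths: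
  `L_{ε'}(p) ≤ C L_ε(p)` for `0 < ε' ≤ ε < 1/2` and `0 < |p - 1/2| < δ` (the other inequality
  `L_ε ≤ L_{ε'}` is `charLength_anti`, `KestenRelationRussoProofs.lean`);
* `charLengthW_le_mul_charLength_of_kesten(_gt)` — the same comparison between Werner's easy-way
  length `L(p, η) = charLengthW η p` (`WernerCorrelationLength.lean`, `η` below the threshold of
  `Werner2009_kestenRelationW`, which supplies the upper Kesten bound at `L(p, η)`) and Nolin's
  `L_ε(p)`, every `ε ∈ (0, 1/2)`: `L(p, η) ≤ C L_ε(p)` near `1/2`. (The inequality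
  `L_η(p) ≤ L(p, η)` is `charLength_le_charLengthW`, `WernerCorrelationLengthProofs.lean`; Werner
  2009, Lecture 6, §1: defining `L` "in terms of crossings of rhombi … does not change its value
  drastically".) This is the hypothesis `hlen` of `Nolin2008_cor41_of_charLengthW_le`
  (`NearCriticalScalingProofs.lean`).

The size threshold `L_ε(p) > 4 r₀` holds near `1/2` by `le_charLength_eventually` (Nolin, Prop. 4).

## References

* P. Nolin, Near-critical percolation in two dimensions, *Electron. J. Probab.* 13 (2008)
  1562–1623, §7.3, Cor. 37 and its proof, Prop. 34 (arXiv 0711.4948: Cor. 35, Prop. 32, p. 26)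
  [Nolin2008].
* W. Werner, Lectures on two-dimensional critical percolation, PCMI (2009), Lecture 6, §1, §3,
  Cor. 6.2, display after Lemma 6.3 [WernerPCMI2009].
* H. Kesten, Scaling relations for 2D-percolation, *Comm. Math. Phys.* 109 (1987)
  [KestenScalingCMP1987].

Tree: `charLength`, `charLength_symm`, `Nolin2008_prop34`, `critFourArmProb` (`KestenScaling.lean`),
`le_charLength_eventually` (`KestenRelationRusso.lean`), `BollobasRiordan2006_ch5_lemma7_holds`
(`KestenRelationRussoProofs.lean`), `Nolin2008_subcritical_crossing_holds` (`NearCriticalRSW.lean`),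
`charLengthW`, `charLengthW_symm`, `Werner2009_kestenRelationW` (`WernerCorrelationLength.lean`),
`fourArmProbAt_half` (`WernerPivotalEstimates.lean`), `Werner2009_fourArm_quasiMult`,
`Werner2009_fourArm_lowerBound` (`NearCriticalFourArmFacts.lean`). Mathlib: `Real.rpow` algebra.
-/

noncomputable section

open MeasureTheory Set Filter Topology
open scoped unitInterval

namespace Literature.Probability.Percolation

open LatticeModels

/-! ### Real analysis and algebra of the proof of Cor. 37 -/

/-- **The exponent step of Cor. 37** (Nolin 2008, proof of Cor. 37 [arXiv: Cor. 35], last two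
displays: `(L_ε/L_{ε'})² ≤ C₂ π₄(L_{ε'}, L_ε)⁻¹` and `π₄(L_{ε'}, L_ε) ≥ C₃ (L_{ε'}/L_ε)^{2-α'}` give
`L_ε ≤ C₄^{1/α'} L_{ε'}`), as pure real analysis: if `0 < L`, `4L < L'`, `β > 0` and
`(4L/L')^{2-β} L'² ≤ K₀ L²`, then `L' ≤ 4 (K₀/16)^{1/β} L` (with `x = L'/(4L)` the hypothesis
reads `16 x^β ≤ K₀`). [cite: Nolin2008, §7.3, proof of Cor. 37 (arXiv 0711.4948: Cor. 35)] -/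
theorem ratio_le_of_rpow_bound {L L' β K₀ : ℝ} (hL : 0 < L) (hLL' : 4 * L < L') (hβ : 0 < β)
    (h : (4 * L / L') ^ (2 - β) * L' ^ 2 ≤ K₀ * L ^ 2) :
    L' ≤ 4 * (K₀ / 16) ^ (1 / β) * L := by
  have hL'0 : 0 < L' := by linarith
  obtain ⟨x, hx0, rfl⟩ : ∃ x : ℝ, 0 < x ∧ L' = 4 * L * x :=
    ⟨L' / (4 * L), by positivity, by field_simp⟩
  have hinv : 4 * L / (4 * L * x) = x⁻¹ := by
    field_simp
  rw [hinv, Real.inv_rpow hx0.le, Real.rpow_sub hx0, Real.rpow_two, inv_div] at h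
  -- `h : x ^ β / x ^ 2 * (4 * L * x) ^ 2 ≤ K₀ * L ^ 2`
  have hx2 : (0 : ℝ) < x ^ 2 := by positivity
  have h16 : x ^ β / x ^ 2 * (4 * L * x) ^ 2 = L ^ 2 * (16 * x ^ β) := by
    field_simp
    ring
  rw [h16] at h
  have h' : L ^ 2 * (16 * x ^ β) ≤ L ^ 2 * K₀ := by linarith
  have hxβ : x ^ β ≤ K₀ / 16 := by
    have := le_of_mul_le_mul_left h' (pow_pos hL 2)
    rw [le_div_iff₀ (by norm_num : (0 : ℝ) < 16)]
    linarith
  have hxle : x ≤ (K₀ / 16) ^ (1 / β) := by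
    have := Real.rpow_le_rpow (Real.rpow_nonneg hx0.le β) hxβ (by positivity : (0 : ℝ) ≤ 1 / β)
    rwa [← Real.rpow_mul hx0.le, mul_one_div_cancel hβ.ne', Real.rpow_one] at this
  calc 4 * L * x ≤ 4 * L * (K₀ / 16) ^ (1 / β) := by gcongr
    _ = 4 * (K₀ / 16) ^ (1 / β) * L := by ring

/-- **The chain of inequalities of Cor. 37** (Nolin 2008, proof of Cor. 37 [arXiv: Cor. 35]):
from `c₁ ≤ a L² π₄(r₀, L)` and `a L'² π₄(r₀, L') ≤ C₂` (Kesten's relation at the two lengths,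
`a = |p - 1/2|`), quasi-multiplicativity `c_q π₄(r₀, L) π₄(4L, L') ≤ π₄(r₀, L')` and the a-priori
bound `c_l ρ ≤ π₄(4L, L')` (`ρ = (4L/L')^{2-β}`), one gets `c₁ c_q c_l ρ L'² ≤ |C₂| L²`. Pure
algebra. [cite: Nolin2008, §7.3, proof of Cor. 37 (arXiv 0711.4948: Cor. 35)] -/
theorem cor37_algebra {a L L' π₁ π₂ π₃ ρ c₁ cq cl C₂ : ℝ} (ha : 0 ≤ a)
    (hπ₁ : 0 ≤ π₁) (hρ : 0 ≤ ρ) (hcq : 0 ≤ cq) (hcl : 0 ≤ cl)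
    (hc₁ : c₁ ≤ a * L ^ 2 * π₁) (hC₂ : a * L' ^ 2 * π₂ ≤ C₂)
    (hq1 : cq * (π₁ * π₃) ≤ π₂) (hl1 : cl * ρ ≤ π₃) :
    c₁ * cq * cl * (ρ * L' ^ 2) ≤ |C₂| * L ^ 2 := by
  have h0 : 0 ≤ cq * cl * ρ * L' ^ 2 := by positivity
  calc c₁ * cq * cl * (ρ * L' ^ 2) = (cq * cl * ρ * L' ^ 2) * c₁ := by ring
    _ ≤ (cq * cl * ρ * L' ^ 2) * (a * L ^ 2 * π₁) := mul_le_mul_of_nonneg_left hc₁ h0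
    _ = L ^ 2 * (a * L' ^ 2 * (cq * (π₁ * (cl * ρ)))) := by ring
    _ ≤ L ^ 2 * (a * L' ^ 2 * (cq * (π₁ * π₃))) :=
        mul_le_mul_of_nonneg_left (mul_le_mul_of_nonneg_left
          (mul_le_mul_of_nonneg_left (mul_le_mul_of_nonneg_left hl1 hπ₁) hcq) (by positivity))
          (sq_nonneg _)
    _ ≤ L ^ 2 * (a * L' ^ 2 * π₂) :=
        mul_le_mul_of_nonneg_left (mul_le_mul_of_nonneg_left hq1 (by positivity)) (sq_nonneg _)
    _ ≤ L ^ 2 * C₂ := mul_le_mul_of_nonneg_left hC₂ (sq_nonneg _)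
    _ ≤ L ^ 2 * |C₂| := mul_le_mul_of_nonneg_left (le_abs_self _) (sq_nonneg _)
    _ = |C₂| * L ^ 2 := mul_comm _ _

/-- **The proof of Cor. 37 for an abstract pair of scales** (Nolin 2008, proof of Cor. 37
[arXiv 0711.4948: Cor. 35]). Let quasi-multiplicativity `c_q π₄(r, R) π₄(4R, S) ≤ π₄(r, S)`
(`r ≥ r_q`, `16 r < 4R < S`) and the a-priori bound `c_l (m/n)^{2-β} ≤ π₄(m, n)` (`r_l ≤ m ≤ n`)
hold for the critical four-arm probability, and let `r₀ ≥ r_q, r_l`. If two scales `L, L'` with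
`L > 4 r₀` satisfy the lower Kesten bound `c₁ ≤ a L² π₄(r₀, L)` and the upper one
`a L'² π₄(r₀, L') ≤ C₂` (same `a ≥ 0`), then `L' ≤ K L` with
`K = max 4 (4 (|C₂|/(16 c₁ c_q c_l))^{1/β})`, a constant independent of `a, L, L'`: either
`L' ≤ 4L`, or `π₄(r₀, L') ≥ c_q π₄(r₀, L) π₄(4L, L') ≥ c_q c_l π₄(r₀, L) (4L/L')^{2-β}` and the two
Kesten bounds give `(4L/L')^{2-β} L'² ≤ K₀ L²` (`cor37_algebra`, `ratio_le_of_rpow_bound`). [cite: Nolin2008, §7.3, proof of Cor. 37 (arXiv 0711.4948: Cor. 35)] -/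
theorem length_le_mul_of_kesten_bounds {rq rl r₀ L L' : ℕ} {β cq cl a c₁ C₂ : ℝ} (hβ : 0 < β)
    (hcq : 0 < cq) (hcl : 0 < cl) (hc₁ : 0 < c₁)
    (Hq : ∀ r R S : ℕ, rq ≤ r → 16 * r < 4 * R → 4 * R < S →
      cq * (critFourArmProb r R * critFourArmProb (4 * R) S) ≤ critFourArmProb r S)
    (Hl : ∀ m n : ℕ, rl ≤ m → m ≤ n → cl * ((m : ℝ) / n) ^ (2 - β) ≤ critFourArmProb m n)
    (hrq : rq ≤ r₀) (hrl : rl ≤ r₀) (hL : 4 * r₀ + 1 ≤ L) (ha : 0 ≤ a)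
    (hlow : c₁ ≤ a * (L : ℝ) ^ 2 * critFourArmProb r₀ L)
    (hup : a * (L' : ℝ) ^ 2 * critFourArmProb r₀ L' ≤ C₂) :
    (L' : ℝ) ≤ max 4 (4 * (|C₂| / (c₁ * cq * cl) / 16) ^ (1 / β)) * L := by
  have hLpos : (0 : ℝ) < L := by exact_mod_cast (show 0 < L by omega)
  rcases le_or_gt L' (4 * L) with hcase | hcase
  · calc (L' : ℝ) ≤ 4 * L := by exact_mod_cast hcase
      _ ≤ max 4 (4 * (|C₂| / (c₁ * cq * cl) / 16) ^ (1 / β)) * L :=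
          mul_le_mul_of_nonneg_right (le_max_left _ _) hLpos.le
  · -- `4 L < L'`: quasi-multiplicativity and the a-priori bound
    have hq1 := Hq r₀ L L' hrq (by omega) hcase
    have hl1 := Hl (4 * L) L' (by omega) hcase.le
    rw [Nat.cast_mul, Nat.cast_ofNat] at hl1
    have key := cor37_algebra ha measureReal_nonneg (Real.rpow_nonneg (by positivity) _)
      hcq.le hcl.le hlow hup hq1 hl1
    have hmain : (4 * (L : ℝ) / L') ^ (2 - β) * (L' : ℝ) ^ 2 ≤
        |C₂| / (c₁ * cq * cl) * (L : ℝ) ^ 2 := by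
      rw [div_mul_eq_mul_div, le_div_iff₀ (by positivity)]
      calc (4 * (L : ℝ) / L') ^ (2 - β) * (L' : ℝ) ^ 2 * (c₁ * cq * cl)
            = c₁ * cq * cl * ((4 * (L : ℝ) / L') ^ (2 - β) * (L' : ℝ) ^ 2) := by ring
        _ ≤ |C₂| * (L : ℝ) ^ 2 := key
    have hcase' : 4 * (L : ℝ) < L' := by exact_mod_cast hcase
    calc (L' : ℝ) ≤ 4 * (|C₂| / (c₁ * cq * cl) / 16) ^ (1 / β) * L :=
          ratio_le_of_rpow_bound hLpos hcase' hβ hmain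
      _ ≤ max 4 (4 * (|C₂| / (c₁ * cq * cl) / 16) ^ (1 / β)) * L :=
          mul_le_mul_of_nonneg_right (le_max_right _ _) hLpos.le

/-- **Werner's two four-arm facts at `t = 1/2`.** `Werner2009_fourArm_quasiMult` and
`Werner2009_fourArm_lowerBound` specialised to the critical parameter, where they carry no upper
restriction on the radii and `fourArmProbAt half = critFourArmProb`: thresholds `r_q, r_l`, an
exponent defect `β > 0` and constants `c_q, c_l > 0` with `c_q π₄(r, R) π₄(4R, S) ≤ π₄(r, S)` for
`r_q ≤ r`, `16 r < 4R < S`, and `c_l (m/n)^{2-β} ≤ π₄(m, n)` for `r_l ≤ m ≤ n` (Werner 2009,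
Lecture 6, Cor. 6.2 and §3; Nolin 2008, Prop. 17 and Thm. 24 at `p = 1/2`). [cite: WernerPCMI2009, Lecture 6, Cor. 6.2 and §3 (third a priori estimate)] -/
theorem critFourArm_quasiMult_lowerBound (hq : Werner2009_fourArm_quasiMult)
    (hl : Werner2009_fourArm_lowerBound) :
    ∃ rq rl : ℕ, ∃ β > (0 : ℝ), ∃ cq > (0 : ℝ), ∃ cl > (0 : ℝ),
      (∀ r R S : ℕ, rq ≤ r → 16 * r < 4 * R → 4 * R < S →
        cq * (critFourArmProb r R * critFourArmProb (4 * R) S) ≤ critFourArmProb r S) ∧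
      (∀ m n : ℕ, rl ≤ m → m ≤ n → cl * ((m : ℝ) / n) ^ (2 - β) ≤ critFourArmProb m n) := by
  obtain ⟨ε₁, hε₁, hq⟩ := hq
  obtain ⟨rq, δq, hδq, cq, hcq, Hq⟩ := hq (half_pos hε₁) (half_lt_self hε₁)
  obtain ⟨ε₂, hε₂, hl⟩ := hl
  obtain ⟨rl, δl, hδl, β, hβ, cl, hcl, Hl⟩ := hl (half_pos hε₂) (half_lt_self hε₂)
  refine ⟨rq, rl, β, hβ, cq, hcq, cl, hcl, fun r R S h1 h2 h3 => ?_, fun m n h1 h2 => ?_⟩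
  · have h := Hq half (by rw [coe_half]) (by rw [coe_half]; linarith) r R S h1 h2 h3
      (fun h => absurd h (by rw [coe_half]; exact lt_irrefl _))
    simpa only [fourArmProbAt_half] using h
  · have h := Hl half (by rw [coe_half]) (by rw [coe_half]; linarith) m n h1 h2
      (fun h => absurd h (by rw [coe_half]; exact lt_irrefl _))
    simpa only [fourArmProbAt_half] using h

/-! ### Nolin's Cor. 37 [arXiv: Cor. 35]: `L_ε ≍ L_{ε'}` -/

/-- **Equivalence of lengths, `p < 1/2`** (Nolin 2008, §7.3, Cor. 37 [arXiv 0711.4948: Cor. 35]: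
"For any `ε, ε' ∈ (0, 1/2)`, `L_ε(p) ≍ L_{ε'}(p)`"; the non-trivial inequality, the other being
`charLength_anti`). For `0 < ε' ≤ ε < 1/2` there are `δ, C > 0` with `L_{ε'}(p) ≤ C L_ε(p)` for
all `p ∈ (1/2 - δ, 1/2)`: Kesten's relation (`Nolin2008_prop34`) at `ε` and at `ε'` with a common
inner radius `r₀` gives `c₁ ≤ a L² π₄(r₀, L)` and `a L'² π₄(r₀, L') ≤ C₂` (`a = |p - 1/2|`,
`L = L_ε(p)`, `L' = L_{ε'}(p)`), `L > 4 r₀` near `1/2` (`le_charLength_eventually`), and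
`length_le_mul_of_kesten_bounds` applies with Werner's two four-arm facts at `t = 1/2`. [cite: Nolin2008, §7.3, Cor. 37 (arXiv 0711.4948: Cor. 35)] -/
theorem charLength_le_mul_charLength_of_kesten_lt (hK : Nolin2008_prop34)
    (hq : Werner2009_fourArm_quasiMult) (hl : Werner2009_fourArm_lowerBound) {ε ε' : ℝ}
    (hε' : 0 < ε') (hle : ε' ≤ ε) (hε : ε < 1 / 2) :
    ∃ δ > (0 : ℝ), ∃ C > (0 : ℝ), ∀ p : unitInterval, 1 / 2 - δ < (p : ℝ) → (p : ℝ) < 1 / 2 →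
      (charLength ε' p : ℝ) ≤ C * charLength ε p := by
  have hε0 : 0 < ε := hε'.trans_le hle
  have hε'2 : ε' < 1 / 2 := hle.trans_lt hε
  obtain ⟨rq, rl, β, hβ, cq, hcq, cl, hcl, Hq, Hl⟩ := critFourArm_quasiMult_lowerBound hq hl
  -- Kesten's relation at `ε` and at `ε'`, with a common inner radius `r₀`
  obtain ⟨r₁, hr₁⟩ := hK hε0 hε
  obtain ⟨r₁', hr₁'⟩ := hK hε' hε'2
  set r₀ : ℕ := max (max r₁ r₁') (max rq rl) with hr₀
  obtain ⟨δ₁, hδ₁, c₁, hc₁, C₁, H₁⟩ := hr₁ r₀ ((le_max_left r₁ r₁').trans (le_max_left _ _))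
  obtain ⟨δ₂, hδ₂, c₂, hc₂, C₂, H₂⟩ := hr₁' r₀ ((le_max_right r₁ r₁').trans (le_max_left _ _))
  have h_rq : rq ≤ r₀ := (le_max_left rq rl).trans (le_max_right _ _)
  have h_rl : rl ≤ r₀ := (le_max_right rq rl).trans (le_max_right _ _)
  -- `L_ε(p) > 4 r₀` near `1/2`
  obtain ⟨δ₃, hδ₃, H₃⟩ := le_charLength_eventually BollobasRiordan2006_ch5_lemma7_holds
    Nolin2008_subcritical_crossing_holds hε0 hε (4 * r₀ + 1)
  refine ⟨min δ₁ (min δ₂ δ₃), lt_min hδ₁ (lt_min hδ₂ hδ₃),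
    max 4 (4 * (|C₂| / (c₁ * cq * cl) / 16) ^ (1 / β)), lt_max_of_lt_left (by norm_num),
    fun p hp1 hp2 => ?_⟩
  have hm1 := min_le_left δ₁ (min δ₂ δ₃)
  have hm2 := (min_le_right δ₁ (min δ₂ δ₃)).trans (min_le_left δ₂ δ₃)
  have hm3 := (min_le_right δ₁ (min δ₂ δ₃)).trans (min_le_right δ₂ δ₃)
  have hpne : (p : ℝ) ≠ 1 / 2 := hp2.ne
  have hpδ₁ : |(p : ℝ) - 1 / 2| < δ₁ := by
    rw [abs_sub_lt_iff]; constructor <;> linarith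
  have hpδ₂ : |(p : ℝ) - 1 / 2| < δ₂ := by
    rw [abs_sub_lt_iff]; constructor <;> linarith
  obtain ⟨hlow, -⟩ := H₁ p hpne hpδ₁
  obtain ⟨-, hup⟩ := H₂ p hpne hpδ₂
  exact length_le_mul_of_kesten_bounds hβ hcq hcl hc₁ Hq Hl h_rq h_rl (H₃ p (by linarith) hp2)
    (abs_nonneg _) hlow hup

/-- **Equivalence of lengths** (Nolin 2008, §7.3, Cor. 37 [arXiv 0711.4948: Cor. 35]: "For any
`ε, ε' ∈ (0, 1/2)`, `L_ε(p) ≍ L_{ε'}(p)`"), on both sides of `1/2`: for `0 < ε' ≤ ε < 1/2` there are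
`δ, C > 0` with `L_{ε'}(p) ≤ C L_ε(p)` whenever `0 < |p - 1/2| < δ` (the case `p > 1/2` is the case
`1 - p` by `L_ε(p) = L_ε(1 - p)`, `charLength_symm`); with `L_ε(p) ≤ L_{ε'}(p)` (`charLength_anti`)
this is `L_ε ≍ L_{ε'}`. [cite: Nolin2008, §7.3, Cor. 37 (arXiv 0711.4948: Cor. 35)] -/
theorem charLength_le_mul_charLength_of_kesten (hK : Nolin2008_prop34)
    (hq : Werner2009_fourArm_quasiMult) (hl : Werner2009_fourArm_lowerBound) {ε ε' : ℝ}
    (hε' : 0 < ε') (hle : ε' ≤ ε) (hε : ε < 1 / 2) :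
    ∃ δ > (0 : ℝ), ∃ C > (0 : ℝ), ∀ p : unitInterval, (p : ℝ) ≠ 1 / 2 → |(p : ℝ) - 1 / 2| < δ →
      (charLength ε' p : ℝ) ≤ C * charLength ε p := by
  obtain ⟨δ, hδ, C, hC, h⟩ := charLength_le_mul_charLength_of_kesten_lt hK hq hl hε' hle hε
  refine ⟨δ, hδ, C, hC, fun p hp hpδ => ?_⟩
  rw [abs_sub_lt_iff] at hpδ
  rcases lt_or_gt_of_ne hp with hlt | hgt
  · exact h p (by linarith [hpδ.2]) hlt
  · have hq1 : ((σ p : unitInterval) : ℝ) = 1 - p := unitInterval.coe_symm_eq p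
    have := h (σ p) (by rw [hq1]; linarith [hpδ.1]) (by rw [hq1]; linarith)
    rwa [charLength_symm, charLength_symm] at this

/-! ### Werner's easy-way length against Nolin's rhombus length -/

/-- **`L(p, η) ≤ C L_ε(p)` for `p > 1/2` near `1/2`** (the comparison of Werner's easy-way length
`charLengthW η`, Werner 2009, Lecture 6, §1, with Nolin's rhombus length `charLength ε`; Nolin
2008, Cor. 37 for the method and Remark after it; Werner, loc. cit.: the rhombus definition "does
not change its value drastically"). For `η` below the threshold of `Werner2009_kestenRelationW`
and every `ε ∈ (0, 1/2)`: the lower Kesten bound at `L_ε(p)` (`Nolin2008_prop34`, both sides of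
`1/2`), the upper one at `L(p, η)` (`Werner2009_kestenRelationW`, `p > 1/2`), `L_ε(p) > 4 r₀` near
`1/2` (`le_charLength_eventually` at `1 - p`, `charLength_symm`), and
`length_le_mul_of_kesten_bounds`. [cite: Nolin2008, §7.3, Cor. 37 and the Remark after it (arXiv 0711.4948: Cor. 35, Remark 36)] [cite: WernerPCMI2009, Lecture 6, §1 (remark on the rhombus definition of L)] -/
theorem charLengthW_le_mul_charLength_of_kesten_gt (hK : Nolin2008_prop34)
    (hKW : Werner2009_kestenRelationW) (hq : Werner2009_fourArm_quasiMult)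
    (hl : Werner2009_fourArm_lowerBound) :
    ∃ η₁ > (0 : ℝ), ∀ ⦃η : ℝ⦄, 0 < η → η < η₁ → ∀ ⦃ε : ℝ⦄, 0 < ε → ε < 1 / 2 →
      ∃ δ > (0 : ℝ), ∃ C > (0 : ℝ), ∀ p : unitInterval, 1 / 2 < (p : ℝ) → (p : ℝ) < 1 / 2 + δ →
        (charLengthW η p : ℝ) ≤ C * charLength ε p := by
  obtain ⟨rq, rl, β, hβ, cq, hcq, cl, hcl, Hq, Hl⟩ := critFourArm_quasiMult_lowerBound hq hl
  obtain ⟨η₁, hη₁, hKW⟩ := hKW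
  refine ⟨η₁, hη₁, fun η hη hηη₁ ε hε hε2 => ?_⟩
  obtain ⟨r₁, hr₁⟩ := hK hε hε2
  obtain ⟨r₁', hr₁'⟩ := hKW hη hηη₁
  set r₀ : ℕ := max (max r₁ r₁') (max rq rl) with hr₀
  obtain ⟨δ₁, hδ₁, c₁, hc₁, C₁, H₁⟩ := hr₁ r₀ ((le_max_left r₁ r₁').trans (le_max_left _ _))
  obtain ⟨δ₂, hδ₂, c₂, hc₂, C₂, H₂⟩ := hr₁' r₀ ((le_max_right r₁ r₁').trans (le_max_left _ _))
  have h_rq : rq ≤ r₀ := (le_max_left rq rl).trans (le_max_right _ _)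
  have h_rl : rl ≤ r₀ := (le_max_right rq rl).trans (le_max_right _ _)
  obtain ⟨δ₃, hδ₃, H₃⟩ := le_charLength_eventually BollobasRiordan2006_ch5_lemma7_holds
    Nolin2008_subcritical_crossing_holds hε hε2 (4 * r₀ + 1)
  refine ⟨min δ₁ (min δ₂ δ₃), lt_min hδ₁ (lt_min hδ₂ hδ₃),
    max 4 (4 * (|C₂| / (c₁ * cq * cl) / 16) ^ (1 / β)), lt_max_of_lt_left (by norm_num),
    fun p hp1 hp2 => ?_⟩
  have hm1 := min_le_left δ₁ (min δ₂ δ₃)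
  have hm2 := (min_le_right δ₁ (min δ₂ δ₃)).trans (min_le_left δ₂ δ₃)
  have hm3 := (min_le_right δ₁ (min δ₂ δ₃)).trans (min_le_right δ₂ δ₃)
  have hpne : (p : ℝ) ≠ 1 / 2 := hp1.ne'
  have hpδ₁ : |(p : ℝ) - 1 / 2| < δ₁ := by
    rw [abs_sub_lt_iff]; constructor <;> linarith
  have habs : |(p : ℝ) - 1 / 2| = (p : ℝ) - 1 / 2 := abs_of_pos (by linarith)
  obtain ⟨hlow, -⟩ := H₁ p hpne hpδ₁
  obtain ⟨-, hup⟩ := H₂ p hp1 (by linarith)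
  rw [habs] at hlow
  -- the size threshold at `1 - p < 1/2`
  have hσ : ((σ p : unitInterval) : ℝ) = 1 - p := unitInterval.coe_symm_eq p
  have hL : 4 * r₀ + 1 ≤ charLength ε p := by
    rw [← charLength_symm]
    exact H₃ (σ p) (by rw [hσ]; linarith) (by rw [hσ]; linarith)
  exact length_le_mul_of_kesten_bounds hβ hcq hcl hc₁ Hq Hl h_rq h_rl hL (by linarith) hlow hup

/-- **`L(p, η) ≤ C L_ε(p)` near `1/2`, both sides** (Werner's easy-way length against Nolin's
rhombus length; both are symmetric under `p ↦ 1 - p`, `charLengthW_symm`, `charLength_symm`): for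
`η` below the threshold of `Werner2009_kestenRelationW` and every `ε ∈ (0, 1/2)` there are
`δ, C > 0` with `charLengthW η p ≤ C · charLength ε p` whenever `0 < |p - 1/2| < δ`. Together with
`L_η(p) ≤ L(p, η)` (`charLength_le_charLengthW`) and Cor. 37 this makes Werner's and Nolin's
lengths equivalent. This is the hypothesis of `Nolin2008_cor41_of_charLengthW_le`
(`NearCriticalScalingProofs.lean`). [cite: Nolin2008, §7.3, Cor. 37 and the Remark after it (arXiv 0711.4948: Cor. 35, Remark 36)] [cite: WernerPCMI2009, Lecture 6, §1 (remark on the rhombus definition of L)] -/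
theorem charLengthW_le_mul_charLength_of_kesten (hK : Nolin2008_prop34)
    (hKW : Werner2009_kestenRelationW) (hq : Werner2009_fourArm_quasiMult)
    (hl : Werner2009_fourArm_lowerBound) :
    ∃ η₁ > (0 : ℝ), ∀ ⦃η : ℝ⦄, 0 < η → η < η₁ → ∀ ⦃ε : ℝ⦄, 0 < ε → ε < 1 / 2 →
      ∃ δ > (0 : ℝ), ∃ C > (0 : ℝ), ∀ p : unitInterval, (p : ℝ) ≠ 1 / 2 →
        |(p : ℝ) - 1 / 2| < δ → (charLengthW η p : ℝ) ≤ C * charLength ε p := by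
  obtain ⟨η₁, hη₁, h⟩ := charLengthW_le_mul_charLength_of_kesten_gt hK hKW hq hl
  refine ⟨η₁, hη₁, fun η hη hηη₁ ε hε hε2 => ?_⟩
  obtain ⟨δ, hδ, C, hC, h⟩ := h hη hηη₁ hε hε2
  refine ⟨δ, hδ, C, hC, fun p hp hpδ => ?_⟩
  rw [abs_sub_lt_iff] at hpδ
  rcases lt_or_gt_of_ne hp with hlt | hgt
  · have hq1 : ((σ p : unitInterval) : ℝ) = 1 - p := unitInterval.coe_symm_eq p
    have := h (σ p) (by rw [hq1]; linarith) (by rw [hq1]; linarith [hpδ.2])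
    rwa [charLength_symm, charLengthW_symm] at this
  · exact h p hgt (by linarith [hpδ.1])

end Literature.Probability.Percolation
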